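import Literature.Computability.AlgebraicComplexity.ST21OrbitHittingSets
import Literature.Computability.AlgebraicComplexity.MS21UniformSVGenerator
import Literature.Computability.AlgebraicComplexity.HittingSetsCoefficientCover
import HarnessLib

/-!
# Saha–Thankey 2021, Thms 6 and 8 AS TYPED (existence and size of hitting sets for the orbits of
# low-individual-degree ROABPs) — discharges by the coefficient cover

Theorem-plus-plumbing companion of `Literature/Computability/AlgebraicComplexity/ST21OrbitHittingSets.lean`
(cell `val-lit`, seat t21; source C. Saha, B. Thankey, *Hitting sets for orbits of circuit classes
and polynomial families*, APPROX/RANDOM 2021, LIPIcs 207:50 [SahaThankey2021]). That file types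
Thms 6 and 8 in EXISTENCE-AND-SIZE form ("a hitting set for `orb(C)` can be computed in `T` time"
→ a hitting set of size `≤ T` EXISTS; explicitness dropped, flagged WEAKER there):

* `sahaThankey2021_thm_6`: `C` = `n`-variate polynomials of individual degree `≤ d` computed by
  width-`w` COMMUTATIVE ROABPs; for `|F| > n²d` (or `F` infinite) a hitting set for `orb(C)` of size
  `≤ (nd)^{c·d·(⌊log₂ w⌋+1)} + c`;
* `sahaThankey2021_thm_8`: `C` = multilinear polynomials computed by width-`w` ROABPs; for
  `|F| > n^{c·w⁴}` (or `F` infinite) a hitting set for `orb(C)` of size `≤ n^{c·w⁶·(⌊log₂ n⌋+1)} + c`.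

This file proves both BY NAME (`sahaThankey2021_thm_6_holds`, `sahaThankey2021_thm_8_holds`,
`c = 10`) by the cell's COEFFICIENT-COVER route (Heintz–Schnorr type engine
`CoeffCover.exists_hittingSet`, tree file `HittingSetsCoefficientCover.lean`; the route used for the
Medini–Shpilka existence-form corollaries, seat p2), NOT by the printed explicit constructions
(§1.3/§4 of the source: rank concentration, characterising sets, …). DISCLOSED DEVIATION: this is
exactly the weaker, existence-only content of the tree's statements.

The cover:
1. **Entry truncation** (`ROABPCover.exists_coeffTable_of_isROABP`): a polynomial of individual
   degree `≤ d` computed by a width-`w` ROABP `1ᵀ M₁(x₁)⋯M_n(x_n) 1` (ST Def. 1 — the entries of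
   `Mᵢ` are ARBITRARY univariate polynomials) is computed by one whose entries have degree `≤ d`:
   write each entry `p = r + x_i^{d+1} q` (division by the monic `X^{d+1}`) and discard the
   `x_i^{d+1}`-parts one factor at a time — the product is additive and homogeneous in each factor
   (`prod_ofFn_update_add/_smul`, induction on the `List.ofFn` product), the other factors do not
   involve `x_i`, so the discarded part is `x_i^{d+1} · h` while everything else has `x_i`-degree
   `≤ d`, forcing `h = 0` (`sum_prod_ofFn_eq_update`). Commutativity of the layers (Def. 2) is not
   needed for a COVER and is dropped (Def. 2 ⊆ Def. 1, `isHittingSetFor_orb_comm_of_roabp`).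
2. **Generic orbit element** (`genOrb`): the bounded-entry ROABP with INDETERMINATE coefficients
   `c_{i,a,b,e}` composed with the INDETERMINATE linear substitution `x ↦ Ax` (Def. 4, the tree's
   `MS2021.affSubst _ A 0`), over the parameter ring in `n·w·w·(d+1) + n·n` variables; its
   `x`-coefficients have parameter-degree `≤ n·(d+1)` (`totalDegree_coeff_genOrb_le`, graded-degree
   bookkeeping as in `MS21SigmaPiSigmaCoefficientMap.lean`), and `map (eval (params c A))`
   specialises it to `(1ᵀ M₁⋯M_n 1)(Ax)` (`map_eval_params_genOrb`).
3. **Engine**: members of the orbit have total degree `≤ n·d`; on a grid `S ⊆ F`, `|S| ≥ 2nd`, the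
   engine yields `H ⊆ Sⁿ` with `|H| ≤ (n·w·w·(d+1) + n·n)·(log₂(|S|ⁿ·n(d+1)+1)+1)+1` hitting the orbit
   (`exists_hittingSet_orb_grid`). Thm 6: `|S| = 2nd ≤ n²d < |F|` for `n ≥ 2`; Thm 8: `d = 1`,
   `|S| = 2n ≤ n^{10w⁴} < |F|` for `n ≥ 2`, `w ≥ 1`. Arithmetic: `thm6_size_bound`, `thm8_size_bound`
   (`w < 2^{⌊log₂ w⌋+1}`, `a ≤ 2^a` inside the logarithm). Degenerate rows: `d = 0` / `n = 0` one
   point, `n = 1` any `d+1` points (identity map as generator, Medini–Shpilka Obs 18 from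
   `MS21UniformSVGenerator.lean`), `w = 0` the empty set (the class is `{0}`).

Definitions introduced (plumbing, with bodies; no `instance`, no `notation`): `ROABPCover.idxC`,
`idxA`, `params`, `bdMat`, `bdROABP`, `genLin`, `genMat`, `genOrb`. No new named fact (D-0026); net
debt `−2`. HONEST FRAMING: literature hygiene — two existence-form typed statements become theorems;
`VP ≠ VNP` is NOT proved and nothing here bears on it (rung V4 untouched).

## References
* [SahaThankey2021] C. Saha, B. Thankey, APPROX/RANDOM 2021, LIPIcs 207:50, Defs. 1, 2, 4 (p. 50:3),
  Thm. 6 (p. 50:4 L18–21), Thm. 8 (p. 50:4 L45–47) (held text `paper:url-9948e557089c` of the typing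
  seat; statements as typed in `ST21OrbitHittingSets.lean`).
* J. Heintz, C.-P. Schnorr, *Testing polynomials which are easy to compute*, STOC 1980, Thm. 4.4 —
  the coefficient-cover engine (`CoeffCover.exists_hittingSet`).
* D. Medini, A. Shpilka, CCC 2021 (LIPIcs 200:19), Obs 18 — generators give hitting sets (the
  identity-map rows; `MS2021.isHittingSetFor_image_piFinset`).
-/

noncomputable section

open MvPolynomial

namespace Literature.Computability.AlgebraicComplexity

namespace SahaThankey2021

namespace ROABPCover

/-! ### The `List.ofFn` matrix product: multilinearity in one position, degrees of entries -/

section ListProd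

variable {R : Type*} [CommRing R] {w : ℕ}

/-- Multilinearity of `M₁ ⋯ M_k` in the `t`-th factor: additivity. [folklore] -/
private theorem prod_ofFn_update_add : ∀ {k : ℕ} (N : Fin k → Matrix (Fin w) (Fin w) R) (t : Fin k)
    (A B : Matrix (Fin w) (Fin w) R),
    (List.ofFn (Function.update N t (A + B))).prod =
      (List.ofFn (Function.update N t A)).prod + (List.ofFn (Function.update N t B)).prod
  | 0, _, t, _, _ => t.elim0
  | k + 1, N, t, A, B => by
    classical
    rw [List.ofFn_succ, List.ofFn_succ, List.ofFn_succ, List.prod_cons, List.prod_cons,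
      List.prod_cons]
    refine Fin.cases ?_ (fun s => ?_) t
    · have htail : ∀ C : Matrix (Fin w) (Fin w) R,
          (fun i : Fin k => Function.update N 0 C i.succ) = fun i => N i.succ := fun C => by
        funext i
        exact Function.update_of_ne (Fin.succ_ne_zero i) _ _
      simp only [Function.update_self, htail, Matrix.add_mul]
    · have hhead : ∀ C : Matrix (Fin w) (Fin w) R, Function.update N s.succ C 0 = N 0 := fun C =>
        Function.update_of_ne (Fin.succ_ne_zero s).symm _ _
      have htail : ∀ C : Matrix (Fin w) (Fin w) R,
          (fun i : Fin k => Function.update N s.succ C i.succ) =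
            Function.update (fun i : Fin k => N i.succ) s C := fun C => by
        funext i
        by_cases h : i = s
        · subst h; simp
        · rw [Function.update_of_ne h, Function.update_of_ne (fun h' => h (Fin.succ_injective _ h'))]
      simp only [hhead, htail, prod_ofFn_update_add (fun i : Fin k => N i.succ) s A B, Matrix.mul_add]

/-- Multilinearity of `M₁ ⋯ M_k` in the `t`-th factor: scalars. [folklore] -/
private theorem prod_ofFn_update_smul : ∀ {k : ℕ} (N : Fin k → Matrix (Fin w) (Fin w) R) (t : Fin k)
    (c : R) (A : Matrix (Fin w) (Fin w) R),
    (List.ofFn (Function.update N t (c • A))).prod = c • (List.ofFn (Function.update N t A)).prod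
  | 0, _, t, _, _ => t.elim0
  | k + 1, N, t, c, A => by
    classical
    rw [List.ofFn_succ, List.ofFn_succ, List.prod_cons, List.prod_cons]
    refine Fin.cases ?_ (fun s => ?_) t
    · have htail : ∀ C : Matrix (Fin w) (Fin w) R,
          (fun i : Fin k => Function.update N 0 C i.succ) = fun i => N i.succ := fun C => by
        funext i
        exact Function.update_of_ne (Fin.succ_ne_zero i) _ _
      simp only [Function.update_self, htail, Matrix.smul_mul]
    · have hhead : ∀ C : Matrix (Fin w) (Fin w) R, Function.update N s.succ C 0 = N 0 := fun C =>
        Function.update_of_ne (Fin.succ_ne_zero s).symm _ _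
      have htail : ∀ C : Matrix (Fin w) (Fin w) R,
          (fun i : Fin k => Function.update N s.succ C i.succ) =
            Function.update (fun i : Fin k => N i.succ) s C := fun C => by
        funext i
        by_cases h : i = s
        · subst h; simp
        · rw [Function.update_of_ne h, Function.update_of_ne (fun h' => h (Fin.succ_injective _ h'))]
      simp only [hhead, htail, prod_ofFn_update_smul (fun i : Fin k => N i.succ) s c A, Matrix.mul_smul]

end ListProd

section Degrees

variable {F : Type*} [Field F] {σ : Type*} {w : ℕ}

/-- Individual degrees of the entries of `M₁ ⋯ M_k` add up along the factors. [folklore] -/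
private theorem degreeOf_prod_ofFn_le (v : σ) : ∀ {k : ℕ} (N : Fin k → Matrix (Fin w) (Fin w) (MvPolynomial σ F))
    (δ : Fin k → ℕ), (∀ i a b, degreeOf v (N i a b) ≤ δ i) →
    ∀ a b, degreeOf v ((List.ofFn N).prod a b) ≤ ∑ i, δ i
  | 0, N, δ, _, a, b => by
    rw [List.ofFn_zero, List.prod_nil, Matrix.one_apply]
    split_ifs
    · rw [degreeOf_one]; exact Nat.zero_le _
    · rw [degreeOf_zero]; exact Nat.zero_le _
  | k + 1, N, δ, h, a, b => by
    classical
    rw [List.ofFn_succ, List.prod_cons, Matrix.mul_apply, Fin.sum_univ_succ]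
    refine (degreeOf_sum_le _ _ _).trans (Finset.sup_le fun c _ => ?_)
    exact (degreeOf_mul_le _ _ _).trans
      (add_le_add (h 0 a c) (degreeOf_prod_ofFn_le v (fun i => N i.succ) (fun i => δ i.succ)
        (fun i => h i.succ) c b))

/-- A univariate polynomial `r(x_i)`, seen in `F[x_1..x_n]`, does not involve `x_v`, `v ≠ i`.
[folklore] -/
private theorem degreeOf_aeval_X_of_ne {n : ℕ} {i v : Fin n} (h : v ≠ i) (r : Polynomial F) :
    degreeOf v (Polynomial.aeval (X i : MvPolynomial (Fin n) F) r) = 0 := by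
  classical
  rw [Polynomial.aeval_eq_sum_range]
  refine Nat.eq_zero_of_le_zero ((degreeOf_sum_le _ _ _).trans (Finset.sup_le fun k _ => ?_))
  rw [smul_eq_C_mul]
  refine (degreeOf_C_mul_le _ _ _).trans ((degreeOf_pow_le _ _ _).trans ?_)
  rw [degreeOf_X_of_ne h, mul_zero]

/-- A univariate polynomial `r(x_i)` of degree `≤ d`, seen in `F[x_1..x_n]`, has `x_i`-degree `≤ d`.
[folklore] -/
private theorem degreeOf_aeval_X_le {n : ℕ} (i : Fin n) {r : Polynomial F} {d : ℕ} (hr : r.natDegree ≤ d) :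
    degreeOf i (Polynomial.aeval (X i : MvPolynomial (Fin n) F) r) ≤ d := by
  classical
  rw [Polynomial.aeval_eq_sum_range]
  refine (degreeOf_sum_le _ _ _).trans (Finset.sup_le fun k hk => ?_)
  rw [smul_eq_C_mul]
  refine (degreeOf_C_mul_le _ _ _).trans ((degreeOf_pow_le _ _ _).trans ?_)
  rw [degreeOf_X_self, mul_one]
  exact (Nat.lt_succ_iff.1 (Finset.mem_range.1 hk)).trans hr

end Degrees

/-! ### Entry truncation: an ROABP computing a polynomial of individual degree `≤ d` may be taken
with entries of degree `≤ d` -/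

section Truncation

variable {F : Type*} [Field F] {n w d : ℕ}

/-- **One truncation step.** If the factors other than the `t`-th do not involve `x_t`, the `t`-th
factor is `A + x_t^{d+1} Q` with `deg_{x_t} A ≤ d` entrywise, and the computed polynomial
`f = 1ᵀ M₁⋯M_n 1` has `deg_{x_t} f ≤ d`, then replacing the `t`-th factor by `A` computes the same
`f` (the `x_t^{d+1}`-multiple part vanishes by comparing `x_t`-degrees). [folklore] -/
private theorem sum_prod_ofFn_eq_update (N : Fin n → Matrix (Fin w) (Fin w) (MvPolynomial (Fin n) F))
    (t : Fin n) (A Q : Matrix (Fin w) (Fin w) (MvPolynomial (Fin n) F))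
    (hN : ∀ i, i ≠ t → ∀ a b, degreeOf t (N i a b) = 0) (hA : ∀ a b, degreeOf t (A a b) ≤ d)
    (ht : N t = A + (X t : MvPolynomial (Fin n) F) ^ (d + 1) • Q)
    (hf : degreeOf t (∑ a : Fin w, ∑ b : Fin w, (List.ofFn N).prod a b) ≤ d) :
    ∑ a : Fin w, ∑ b : Fin w, (List.ofFn N).prod a b =
      ∑ a : Fin w, ∑ b : Fin w, (List.ofFn (Function.update N t A)).prod a b := by
  classical
  set f := ∑ a : Fin w, ∑ b : Fin w, (List.ofFn N).prod a b with hfdef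
  set g := ∑ a : Fin w, ∑ b : Fin w, (List.ofFn (Function.update N t A)).prod a b with hgdef
  set h := ∑ a : Fin w, ∑ b : Fin w, (List.ofFn (Function.update N t Q)).prod a b with hhdef
  -- `f = g + x_t^{d+1} h`
  have hsplit : f = g + h * X t ^ (d + 1) := by
    have h0 : N = Function.update N t (A + (X t : MvPolynomial (Fin n) F) ^ (d + 1) • Q) := by
      rw [← ht, Function.update_eq_self]
    rw [hfdef, h0, prod_ofFn_update_add, prod_ofFn_update_smul, hgdef, hhdef]
    simp only [Matrix.add_apply, Matrix.smul_apply, smul_eq_mul, Finset.sum_add_distrib,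
      ← Finset.mul_sum]
    ring
  -- `deg_{x_t} g ≤ d`
  have hg : degreeOf t g ≤ d := by
    rw [hgdef]
    refine (degreeOf_sum_le _ _ _).trans (Finset.sup_le fun a _ =>
      (degreeOf_sum_le _ _ _).trans (Finset.sup_le fun b _ => ?_))
    have hδ := degreeOf_prod_ofFn_le t (Function.update N t A) (fun i => if i = t then d else 0)
      (fun i a' b' => by
        by_cases hi : i = t
        · subst hi; rw [Function.update_self, if_pos rfl]; exact hA a' b'
        · rw [Function.update_of_ne hi, if_neg hi, hN i hi a' b']) a b
    simpa using hδ
  -- hence `h = 0`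
  have hh : h = 0 := by
    by_contra hne
    have h1 : degreeOf t (h * X t ^ (d + 1)) = degreeOf t h + (d + 1) :=
      degreeOf_mul_X_self_pow_eq_add_of_ne_zero t (d + 1) hne
    have h2 : degreeOf t (h * X t ^ (d + 1)) ≤ d := by
      have : h * X t ^ (d + 1) = f - g := by rw [hsplit]; ring
      rw [this]
      exact (degreeOf_sub_le _ _ _).trans (max_le hf hg)
    omega
  rw [hsplit, hh, zero_mul, add_zero]

/-- **Entry truncation (normal form).** A polynomial of individual degree `≤ d` computed by a
width-`w` ROABP (ST Def. 1, entries arbitrary univariate polynomials) is computed by a width-`w`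
ROABP whose `(a,b)` entry of the `i`-th factor is `∑_{e ≤ d} c_{i,a,b,e} x_i^e`: write each entry
`p(x_i) = r(x_i) + x_i^{d+1} q(x_i)` (`deg r ≤ d`, division by the monic `X^{d+1}`) and drop the
`x_i^{d+1}`-parts one factor at a time (`sum_prod_ofFn_eq_update`); the normal form behind the
coefficient cover of the classes of Thms 6 and 8. [cite: SahaThankey2021, Def. 1 (p. 50:3) and Thms 6, 8 (p. 50:4)] -/
theorem exists_coeffTable_of_isROABP {f : MvPolynomial (Fin n) F} (hf : IsROABP F w f)
    (hd : ∀ i, f.degreeOf i ≤ d) :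
    ∃ c : Fin n → Fin w → Fin w → Fin (d + 1) → F,
      f = ∑ a : Fin w, ∑ b : Fin w, (List.ofFn fun i => Matrix.of fun a b =>
        ∑ e : Fin (d + 1), C (c i a b e) * (X i : MvPolynomial (Fin n) F) ^ (e : ℕ)).prod a b := by
  classical
  obtain ⟨M, hM, hfM⟩ := hf
  choose P hP using hM
  have hgm : (Polynomial.X ^ (d + 1) : Polynomial F).Monic := Polynomial.monic_X_pow _
  have hg1 : (Polynomial.X ^ (d + 1) : Polynomial F) ≠ 1 := by
    intro h
    have := congr_arg Polynomial.natDegree h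
    rw [Polynomial.natDegree_X_pow, Polynomial.natDegree_one] at this
    omega
  -- truncated factors and quotients
  set Mt : Fin n → Matrix (Fin w) (Fin w) (MvPolynomial (Fin n) F) := fun i => Matrix.of fun a b =>
    Polynomial.aeval (X i : MvPolynomial (Fin n) F) (P i a b %ₘ Polynomial.X ^ (d + 1)) with hMt
  set Q : Fin n → Matrix (Fin w) (Fin w) (MvPolynomial (Fin n) F) := fun i => Matrix.of fun a b =>
    Polynomial.aeval (X i : MvPolynomial (Fin n) F) (P i a b /ₘ Polynomial.X ^ (d + 1)) with hQ
  have hsplit : ∀ i, M i = Mt i + (X i : MvPolynomial (Fin n) F) ^ (d + 1) • Q i := by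
    intro i
    ext a b
    simp only [hMt, hQ, Matrix.add_apply, Matrix.smul_apply, Matrix.of_apply, smul_eq_mul]
    rw [hP i a b]
    conv_lhs => rw [← Polynomial.modByMonic_add_div (P i a b) (Polynomial.X ^ (d + 1))]
    rw [map_add, map_mul, map_pow, Polynomial.aeval_X]
  -- the partially truncated families `N t` (factors `< t` truncated)
  set N : ℕ → Fin n → Matrix (Fin w) (Fin w) (MvPolynomial (Fin n) F) :=
    fun t i => if (i : ℕ) < t then Mt i else M i with hNdef
  have hNsucc : ∀ t : Fin n, N (t + 1) = Function.update (N t) t (Mt t) := by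
    intro t
    funext i
    by_cases hi : i = t
    · subst hi
      simp only [hNdef, Function.update_self, Nat.lt_succ_self, if_true]
    · rw [Function.update_of_ne hi]
      have hne : (i : ℕ) ≠ t := fun h => hi (Fin.ext h)
      simp only [hNdef]
      by_cases hlt : (i : ℕ) < t
      · rw [if_pos hlt, if_pos (by omega)]
      · rw [if_neg hlt, if_neg (by omega)]
  have hdeg0 : ∀ (t : ℕ) (i v : Fin n), v ≠ i → ∀ a b, degreeOf v (N t i a b) = 0 := by
    intro t i v hvi a b
    simp only [hNdef]
    split_ifs
    · exact degreeOf_aeval_X_of_ne hvi _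
    · rw [hP]
      exact degreeOf_aeval_X_of_ne hvi _
  have hdegMt : ∀ i a b, degreeOf i (Mt i a b) ≤ d := by
    intro i a b
    refine degreeOf_aeval_X_le i (Nat.lt_succ_iff.1 ?_)
    have := Polynomial.natDegree_modByMonic_lt (P i a b) hgm hg1
    rwa [Polynomial.natDegree_X_pow] at this
  -- induction over the positions
  have key : ∀ t : ℕ, t ≤ n → f = ∑ a : Fin w, ∑ b : Fin w, (List.ofFn (N t)).prod a b := by
    intro t
    induction t with
    | zero =>
      intro _
      have hN0 : N 0 = M := by
        funext i
        simp only [hNdef, Nat.not_lt_zero, if_false]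
      rw [hN0]
      exact hfM
    | succ t ih =>
      intro ht
      have htn : t < n := ht
      have hprev := ih htn.le
      rw [show N (t + 1) = Function.update (N t) ⟨t, htn⟩ (Mt ⟨t, htn⟩) from hNsucc ⟨t, htn⟩,
        ← sum_prod_ofFn_eq_update (N t) ⟨t, htn⟩ (Mt ⟨t, htn⟩) (Q ⟨t, htn⟩)
          (fun i hi a b => hdeg0 t i _ (Ne.symm hi) a b) (hdegMt _) ?_ ?_]
      · exact hprev
      · have : N t ⟨t, htn⟩ = M ⟨t, htn⟩ := by simp only [hNdef, lt_irrefl, if_false]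
        rw [this]
        exact hsplit _
      · rw [← hprev]
        exact hd _
  -- the final family
  refine ⟨fun i a b e => (P i a b %ₘ Polynomial.X ^ (d + 1)).coeff e, ?_⟩
  have hNn : N n = fun i => Matrix.of fun a b => ∑ e : Fin (d + 1),
      C ((P i a b %ₘ Polynomial.X ^ (d + 1)).coeff e) * (X i : MvPolynomial (Fin n) F) ^ (e : ℕ) := by
    funext i
    have hi : N n i = Mt i := by simp only [hNdef, i.isLt, if_true]
    rw [hi]
    ext a b
    simp only [hMt, Matrix.of_apply]
    have hlt : (P i a b %ₘ Polynomial.X ^ (d + 1)).natDegree < d + 1 := by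
      have := Polynomial.natDegree_modByMonic_lt (P i a b) hgm hg1
      rwa [Polynomial.natDegree_X_pow] at this
    rw [Polynomial.aeval_eq_sum_range' hlt, ← Fin.sum_univ_eq_sum_range
      (fun k => (P i a b %ₘ Polynomial.X ^ (d + 1)).coeff k • (X i : MvPolynomial (Fin n) F) ^ k)]
    simp only [smul_eq_C_mul]
  rw [key n le_rfl, hNn]

end Truncation

/-! ### The generic bounded-entry ROABP composed with the generic linear substitution -/

section Generic

variable (F : Type*) [Field F] (n w d : ℕ)

/-- Parameter index of the coefficient `c_{i,a,b,e}` (of `x_i^e` in the `(a,b)` entry of the `i`-th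
factor). [cite: SahaThankey2021, Def. 1 (p. 50:3)] -/
def idxC (i : Fin n) (a b : Fin w) (e : Fin (d + 1)) : Fin (n * (w * (w * (d + 1))) + n * n) :=
  Fin.castAdd (n * n) (finProdFinEquiv (i, finProdFinEquiv (a, finProdFinEquiv (b, e))))

/-- Parameter index of the matrix entry `A_{i,j}` of the linear substitution `x ↦ Ax` (Def. 4).
[cite: SahaThankey2021, Def. 4 (p. 50:3)] -/
def idxA (i j : Fin n) : Fin (n * (w * (w * (d + 1))) + n * n) :=
  Fin.natAdd (n * (w * (w * (d + 1)))) (finProdFinEquiv (i, j))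

/-- The parameter point of a concrete coefficient table `c` and matrix `A`.
[cite: SahaThankey2021, Defs. 1, 4 (p. 50:3)] -/
def params (c : Fin n → Fin w → Fin w → Fin (d + 1) → F) (A : Matrix (Fin n) (Fin n) F) :
    Fin (n * (w * (w * (d + 1))) + n * n) → F :=
  Fin.addCases (motive := fun _ => F)
    (fun l => c (finProdFinEquiv.symm l).1 (finProdFinEquiv.symm (finProdFinEquiv.symm l).2).1
      (finProdFinEquiv.symm (finProdFinEquiv.symm (finProdFinEquiv.symm l).2).2).1
      (finProdFinEquiv.symm (finProdFinEquiv.symm (finProdFinEquiv.symm l).2).2).2)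
    (fun l => A (finProdFinEquiv.symm l).1 (finProdFinEquiv.symm l).2)

variable {F n w d}

omit [Field F] in
/-- `params` reads `c i a b e` at `idxC i a b e`. [cite: SahaThankey2021, Def. 1 (p. 50:3)] -/
@[simp] theorem params_idxC (c : Fin n → Fin w → Fin w → Fin (d + 1) → F) (A : Matrix (Fin n) (Fin n) F)
    (i : Fin n) (a b : Fin w) (e : Fin (d + 1)) : params F n w d c A (idxC n w d i a b e) = c i a b e := by
  simp only [params, idxC, Fin.addCases_left, Equiv.symm_apply_apply]

omit [Field F] in
/-- `params` reads `A i j` at `idxA i j`. [cite: SahaThankey2021, Def. 4 (p. 50:3)] -/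
@[simp] theorem params_idxA (c : Fin n → Fin w → Fin w → Fin (d + 1) → F) (A : Matrix (Fin n) (Fin n) F)
    (i j : Fin n) : params F n w d c A (idxA n w d i j) = A i j := by
  simp only [params, idxA, Fin.addCases_right, Equiv.symm_apply_apply]

variable (F n w d)

/-- The bounded-entry ROABP factor `M_i(x_i) = (∑_{e ≤ d} c_{i,a,b,e} x_i^e)_{a,b}` of a coefficient
table `c`. [cite: SahaThankey2021, Def. 1 (p. 50:3)] -/
def bdMat (c : Fin n → Fin w → Fin w → Fin (d + 1) → F) (i : Fin n) :
    Matrix (Fin w) (Fin w) (MvPolynomial (Fin n) F) :=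
  Matrix.of fun a b => ∑ e : Fin (d + 1), C (c i a b e) * (X i : MvPolynomial (Fin n) F) ^ (e : ℕ)

/-- The polynomial `1ᵀ M₁(x₁)⋯M_n(x_n) 1` of the bounded-entry ROABP with coefficient table `c`.
[cite: SahaThankey2021, Def. 1 (p. 50:3)] -/
def bdROABP (c : Fin n → Fin w → Fin w → Fin (d + 1) → F) : MvPolynomial (Fin n) F :=
  ∑ a : Fin w, ∑ b : Fin w, (List.ofFn (bdMat F n w d c)).prod a b

/-- The GENERIC linear form `(Ax)_i = ∑_j A_{i,j} x_j` with indeterminate `A` over the parameter ring.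
[cite: SahaThankey2021, Def. 4 (p. 50:3)] -/
def genLin (i : Fin n) : MvPolynomial (Fin n) (MvPolynomial (Fin (n * (w * (w * (d + 1))) + n * n)) F) :=
  ∑ j : Fin n, C (X (idxA n w d i j)) * X j

/-- The GENERIC orbit factor `M_i((Ax)_i)` with indeterminate coefficients and matrix.
[cite: SahaThankey2021, Defs. 1, 4 (p. 50:3)] -/
def genMat (i : Fin n) :
    Matrix (Fin w) (Fin w) (MvPolynomial (Fin n) (MvPolynomial (Fin (n * (w * (w * (d + 1))) + n * n)) F)) :=
  Matrix.of fun a b => ∑ e : Fin (d + 1), C (X (idxC n w d i a b e)) * genLin F n w d i ^ (e : ℕ)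

/-- The GENERIC orbit element `(1ᵀ M₁⋯M_n 1)(Ax)` of a bounded-entry width-`w` ROABP, over the
parameter ring `F[c, A]` (`n·w·w·(d+1) + n·n` parameters). [cite: SahaThankey2021, Defs. 1, 4 (p. 50:3)] -/
def genOrb : MvPolynomial (Fin n) (MvPolynomial (Fin (n * (w * (w * (d + 1))) + n * n)) F) :=
  ∑ a : Fin w, ∑ b : Fin w, (List.ofFn (genMat F n w d)).prod a b

variable {F n w d}

/-- A ring map pushed through `∑_{a,b} (M₁⋯M_k)_{a,b}` acts factor by factor, entry by entry. [folklore] -/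
private theorem map_sum_prod_ofFn {R S : Type*} [CommSemiring R] [CommSemiring S] (φ : R →+* S) {k : ℕ}
    (N : Fin k → Matrix (Fin w) (Fin w) R) :
    φ (∑ a : Fin w, ∑ b : Fin w, (List.ofFn N).prod a b) =
      ∑ a : Fin w, ∑ b : Fin w, (List.ofFn fun i => (N i).map φ).prod a b := by
  rw [map_sum]
  refine Finset.sum_congr rfl fun a _ => ?_
  rw [map_sum]
  refine Finset.sum_congr rfl fun b _ => ?_
  have hL : (List.ofFn fun i => (N i).map φ) = (List.ofFn N).map φ.mapMatrix := by
    rw [List.map_ofFn]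
    rfl
  rw [hL, ← map_list_prod, RingHom.mapMatrix_apply, Matrix.map_apply]

/-- `map_sum_prod_ofFn` for an algebra map. [folklore] -/
private theorem aeval_sum_prod_ofFn {R : Type*} [CommSemiring R] {σ τ : Type*} (ψ : σ → MvPolynomial τ R)
    {k : ℕ} (N : Fin k → Matrix (Fin w) (Fin w) (MvPolynomial σ R)) :
    aeval ψ (∑ a : Fin w, ∑ b : Fin w, (List.ofFn N).prod a b) =
      ∑ a : Fin w, ∑ b : Fin w, (List.ofFn fun i => (N i).map (aeval ψ)).prod a b := by
  have h := map_sum_prod_ofFn (aeval ψ : MvPolynomial σ R →ₐ[R] MvPolynomial τ R).toRingHom N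
  exact h

/-- **Specialisation.** Evaluating the parameters of the generic orbit element at `(c, A)` gives the
orbit element `(1ᵀ M₁⋯M_n 1)(Ax)` of the bounded-entry ROABP with table `c`
(`MS2021.affSubst _ A 0`, Def. 4: `x_i ↦ (Ax)_i`). [cite: SahaThankey2021, Defs. 1, 4 (p. 50:3)] -/
theorem map_eval_params_genOrb (c : Fin n → Fin w → Fin w → Fin (d + 1) → F)
    (A : Matrix (Fin n) (Fin n) F) (h : n ≤ n) :
    MvPolynomial.map (MvPolynomial.eval (params F n w d c A)) (genOrb F n w d) =
      MS2021.affSubst h A 0 (bdROABP F n w d c) := by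
  classical
  have hcast : ∀ i : Fin n, Fin.castLE h i = i := fun i => Fin.ext rfl
  -- both sides are `∑_{a,b} (∏_i (∑_e c_{i,a,b,e} (Ax)_i^e))_{a,b}`
  have hfam₁ : (fun i => (genMat F n w d i).map
      (MvPolynomial.map (MvPolynomial.eval (params F n w d c A)))) =
      fun i => Matrix.of fun a b => ∑ e : Fin (d + 1), C (c i a b e) *
        (∑ j : Fin n, C (A i j) * (X j : MvPolynomial (Fin n) F)) ^ (e : ℕ) := by
    funext i
    ext a b
    simp only [genMat, genLin, Matrix.map_apply, Matrix.of_apply, map_sum, map_mul, map_pow, map_C,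
      map_X, eval_X, params_idxC, params_idxA]
  have hfam₂ : (fun i => (bdMat F n w d c i).map (aeval fun i : Fin n =>
      (∑ j : Fin n, C (A (Fin.castLE h i) j) * X j) + C ((0 : Fin n → F) (Fin.castLE h i)))) =
      fun i => Matrix.of fun a b => ∑ e : Fin (d + 1), C (c i a b e) *
        (∑ j : Fin n, C (A i j) * (X j : MvPolynomial (Fin n) F)) ^ (e : ℕ) := by
    funext i
    ext a b
    simp only [bdMat, Matrix.map_apply, Matrix.of_apply, map_sum, map_mul, map_pow, aeval_C,
      aeval_X, algebraMap_eq, hcast, Pi.zero_apply, C_0, add_zero]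
  unfold genOrb MS2021.affSubst bdROABP
  rw [map_sum_prod_ofFn, hfam₁, aeval_sum_prod_ofFn, hfam₂]

/-! ### Degrees of the coefficients of the generic orbit element in the parameters -/

section Degree

variable {m q : ℕ}

/-- Graded bound on parameter-degrees of coefficients: sums. [folklore] -/
private theorem coeffDeg_add {D : ℕ} {P Q : MvPolynomial (Fin m) (MvPolynomial (Fin q) F)}
    (hP : ∀ μ, (coeff μ P).totalDegree ≤ D) (hQ : ∀ μ, (coeff μ Q).totalDegree ≤ D) :
    ∀ μ, (coeff μ (P + Q)).totalDegree ≤ D := fun μ => by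
  rw [coeff_add]
  exact (totalDegree_add _ _).trans (max_le (hP μ) (hQ μ))

/-- Graded bound: finite sums. [folklore] -/
private theorem coeffDeg_sum {ι : Type*} (t : Finset ι) {D : ℕ}
    {P : ι → MvPolynomial (Fin m) (MvPolynomial (Fin q) F)}
    (hP : ∀ i ∈ t, ∀ μ, (coeff μ (P i)).totalDegree ≤ D) :
    ∀ μ, (coeff μ (∑ i ∈ t, P i)).totalDegree ≤ D := fun μ => by
  rw [coeff_sum]
  exact totalDegree_finsetSum_le fun i hi => hP i hi μ

/-- Graded bound: products add degrees. [folklore] -/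
private theorem coeffDeg_mul {D E : ℕ} {P Q : MvPolynomial (Fin m) (MvPolynomial (Fin q) F)}
    (hP : ∀ μ, (coeff μ P).totalDegree ≤ D) (hQ : ∀ μ, (coeff μ Q).totalDegree ≤ E) :
    ∀ μ, (coeff μ (P * Q)).totalDegree ≤ D + E := fun μ => by
  classical
  rw [coeff_mul]
  exact totalDegree_finsetSum_le fun x _ =>
    (totalDegree_mul _ _).trans (add_le_add (hP x.1) (hQ x.2))

/-- Graded bound: `1` has parameter-degree `0`. [folklore] -/
private theorem coeffDeg_one : ∀ μ, (coeff μ (1 : MvPolynomial (Fin m) (MvPolynomial (Fin q) F))).totalDegree ≤ 0 :=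
  fun μ => by
  classical
  rw [coeff_one]
  split_ifs <;> simp

/-- Graded bound: `0`. [folklore] -/
private theorem coeffDeg_zero {D : ℕ} : ∀ μ, (coeff μ (0 : MvPolynomial (Fin m) (MvPolynomial (Fin q) F))).totalDegree ≤ D :=
  fun μ => by simp

/-- Graded bound: powers. [folklore] -/
private theorem coeffDeg_pow {D : ℕ} {P : MvPolynomial (Fin m) (MvPolynomial (Fin q) F)}
    (hP : ∀ μ, (coeff μ P).totalDegree ≤ D) : ∀ (e : ℕ) (μ), (coeff μ (P ^ e)).totalDegree ≤ e * D
  | 0, μ => by rw [pow_zero, zero_mul]; exact coeffDeg_one μ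
  | e + 1, μ => by
    rw [pow_succ, Nat.succ_mul]
    exact coeffDeg_mul (coeffDeg_pow hP e) hP μ

/-- A parameter times a variable has parameter-degree `≤ 1`. [folklore] -/
private theorem coeffDeg_C_X_mul_X (l : Fin q) (j : Fin m) :
    ∀ μ, (coeff μ (C (X l) * X j : MvPolynomial (Fin m) (MvPolynomial (Fin q) F))).totalDegree ≤ 1 :=
  fun μ => by
  classical
  rw [coeff_C_mul, coeff_X]
  split_ifs <;> simp [totalDegree_X]

/-- A parameter as a constant has parameter-degree `≤ 1`. [folklore] -/
private theorem coeffDeg_C_X (l : Fin q) :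
    ∀ μ, (coeff μ (C (X l) : MvPolynomial (Fin m) (MvPolynomial (Fin q) F))).totalDegree ≤ 1 :=
  fun μ => by
  classical
  rw [coeff_C]
  split_ifs <;> simp [totalDegree_X]

/-- Degrees of the entries of `M₁⋯M_k` when every factor has coefficient-degrees `≤ D`. [folklore] -/
private theorem coeffDeg_prod_ofFn {D : ℕ} : ∀ {k : ℕ}
    (N : Fin k → Matrix (Fin w) (Fin w) (MvPolynomial (Fin m) (MvPolynomial (Fin q) F))),
    (∀ i a b μ, (coeff μ (N i a b)).totalDegree ≤ D) →
    ∀ a b μ, (coeff μ ((List.ofFn N).prod a b)).totalDegree ≤ k * D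
  | 0, N, _, a, b, μ => by
    classical
    rw [List.ofFn_zero, List.prod_nil, Matrix.one_apply, zero_mul]
    split_ifs
    · exact coeffDeg_one μ
    · exact coeffDeg_zero μ
  | k + 1, N, h, a, b, μ => by
    classical
    rw [List.ofFn_succ, List.prod_cons, Matrix.mul_apply]
    have hk : D + k * D = (k + 1) * D := by ring
    exact (coeffDeg_sum (F := F) Finset.univ (fun c _ => coeffDeg_mul (h 0 a c)
      (coeffDeg_prod_ofFn (fun i => N i.succ) (fun i => h i.succ) c b)) μ).trans hk.le

end Degree

/-- **The coefficients of the generic orbit element have degree `≤ n·(d+1)` in the parameters**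
(each factor is linear in `c` and of degree `≤ d` in `A`). [cite: SahaThankey2021, Defs. 1, 4 (p. 50:3)] -/
theorem totalDegree_coeff_genOrb_le (μ : Fin n →₀ ℕ) :
    (coeff μ (genOrb F n w d)).totalDegree ≤ n * (d + 1) := by
  classical
  have hlin : ∀ i μ, (coeff μ (genLin F n w d i)).totalDegree ≤ 1 := fun i =>
    coeffDeg_sum (F := F) Finset.univ (fun j _ => coeffDeg_C_X_mul_X _ _)
  have hent : ∀ i a b μ, (coeff μ (genMat F n w d i a b)).totalDegree ≤ d + 1 := by
    intro i a b
    simp only [genMat, Matrix.of_apply]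
    refine coeffDeg_sum (F := F) Finset.univ fun e _ μ => ?_
    have h := coeffDeg_mul (coeffDeg_C_X (idxC n w d i a b e)) (coeffDeg_pow (hlin i) (e : ℕ)) μ
    refine h.trans ?_
    have : (e : ℕ) * 1 ≤ d := by have := e.isLt; omega
    omega
  unfold genOrb
  refine coeffDeg_sum (F := F) Finset.univ (fun a _ => coeffDeg_sum (F := F) Finset.univ
    fun b _ μ => ?_) μ
  exact coeffDeg_prod_ofFn (genMat F n w d) hent a b μ

end Generic

/-! ### Packaging for the coefficient-cover engine -/

section Cover

variable {F : Type*} [Field F] {n w d : ℕ}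

/-- A polynomial with individual degrees `≤ d` in `n` variables has total degree `≤ n·d`. [folklore] -/
private theorem totalDegree_le_of_degreeOf_le {f : MvPolynomial (Fin n) F} (hd : ∀ i, f.degreeOf i ≤ d) :
    f.totalDegree ≤ n * d := by
  classical
  rw [totalDegree]
  refine Finset.sup_le fun m hm => ?_
  calc (m.sum fun _ e => e) = ∑ i ∈ m.support, m i := rfl
    _ ≤ ∑ i : Fin n, m i := Finset.sum_le_sum_of_subset_of_nonneg (Finset.subset_univ _)
        (fun _ _ _ => Nat.zero_le _)
    _ ≤ ∑ _i : Fin n, d := Finset.sum_le_sum fun i _ => (monomial_le_degreeOf i hm).trans (hd i)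
    _ = n * d := by rw [Finset.sum_const, Finset.card_univ, Fintype.card_fin, smul_eq_mul]

/-- Members of the orbit of the class of ST Thm 6 / Thm 8 have total degree `≤ n·d` (ROABP part
irrelevant). [cite: SahaThankey2021, Thms 6, 8 (p. 50:4)] -/
theorem totalDegree_le_of_mem_orb {P : MvPolynomial (Fin n) F → Prop} {g : MvPolynomial (Fin n) F}
    (hg : g ∈ orb F {f : MvPolynomial (Fin n) F | (∀ i, f.degreeOf i ≤ d) ∧ P f}) :
    g.totalDegree ≤ n * d := by
  rw [mem_orb_iff] at hg
  obtain ⟨f, ⟨hfd, -⟩, h, A, -, rfl⟩ := hg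
  exact (MS2021.totalDegree_affSubst_le h A 0 f).trans (totalDegree_le_of_degreeOf_le hfd)

/-- **The orbit of the bounded-individual-degree width-`w` ROABPs as a coefficient parametrisation**
(the input of the coefficient-cover engine `CoeffCover.exists_hittingSet`): `n·w·w·(d+1) + n·n`
parameters, coordinates of degree `≤ n·(d+1)`, covering `orb{f : deg_{x_i} f ≤ d, f ∈ ROABP_w}`
(entry truncation + specialisation). [cite: SahaThankey2021, Thms 6, 8 (p. 50:4); HeintzSchnorr1980, Thm. 4.4] -/
theorem exists_coeff_parametrisation_orb (n w d D : ℕ) :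
    ∃ Gm : {μ : Fin n →₀ ℕ | μ.degree ≤ D} → MvPolynomial (Fin (n * (w * (w * (d + 1))) + n * n)) F,
      (∀ μ, (Gm μ).totalDegree ≤ n * (d + 1)) ∧
      ∀ g ∈ orb F {f : MvPolynomial (Fin n) F | (∀ i, f.degreeOf i ≤ d) ∧ IsROABP F w f},
        ∃ y : Fin (n * (w * (w * (d + 1))) + n * n) → F, ∀ μ, eval y (Gm μ) = coeff (μ : Fin n →₀ ℕ) g := by
  refine ⟨fun μ => coeff (μ : Fin n →₀ ℕ) (genOrb F n w d), fun μ => totalDegree_coeff_genOrb_le _,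
    fun g hg => ?_⟩
  rw [mem_orb_iff] at hg
  obtain ⟨f, ⟨hfd, hf⟩, h, A, -, rfl⟩ := hg
  obtain ⟨c, rfl⟩ := exists_coeffTable_of_isROABP hf hfd
  refine ⟨params F n w d c A, fun μ => ?_⟩
  rw [← coeff_map, map_eval_params_genOrb c A h]
  rfl

/-- **Coefficient-cover hitting sets for the orbit of bounded-individual-degree ROABPs.** For a
nonempty grid `S ⊆ F` with `|S| ≥ 2nd` some `H ⊆ Sⁿ` with
`|H| ≤ (n·w·w·(d+1) + n·n)·(log₂(|S|ⁿ·n(d+1) + 1) + 1) + 1` hits every nonzero member of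
`orb{f : deg_{x_i} f ≤ d ∀ i, f computed by a width-w ROABP}` — the existence-and-size content of
ST Thms 6 and 8, without the printed generator. [cite: SahaThankey2021, Thms 6, 8 (p. 50:4); HeintzSchnorr1980, Thm. 4.4] -/
theorem exists_hittingSet_orb_grid (n w d : ℕ) (S : Finset F) (hS1 : S.Nonempty)
    (hS : 2 * (n * d) ≤ S.card) :
    ∃ H : Finset (Fin n → F),
      H.card ≤ (n * (w * (w * (d + 1))) + n * n) * (Nat.log 2 (S.card ^ n * (n * (d + 1)) + 1) + 1) + 1 ∧
      HittingSets.IsHittingSetFor (↑H)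
        (orb F {f : MvPolynomial (Fin n) F | (∀ i, f.degreeOf i ≤ d) ∧ IsROABP F w f}) := by
  obtain ⟨Gm, hGm, hcov⟩ := exists_coeff_parametrisation_orb (F := F) n w d (n * d)
  obtain ⟨H, -, hHcard, hhit⟩ := CoeffCover.exists_hittingSet (F := F) n (n * d)
    (n * (w * (w * (d + 1))) + n * n) (n * (d + 1)) (Finsupp.finite_of_degree_le (σ := Fin n) (n * d))
    Gm hGm S hS1 hS
  exact ⟨H, hHcard, fun g hg hg0 => hhit g (totalDegree_le_of_mem_orb hg) (hcov g hg) hg0⟩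

/-- The commutative-ROABP class of Thm 6 sits inside the ROABP class (Def. 2 ⊆ Def. 1), so a
hitting set for the orbit of the latter hits the orbit of the former. [cite: SahaThankey2021, Defs. 1–2, Thm 6 (p. 50:3–4)] -/
theorem isHittingSetFor_orb_comm_of_roabp {H : Set (Fin n → F)}
    (hH : HittingSets.IsHittingSetFor H
      (orb F {f : MvPolynomial (Fin n) F | (∀ i, f.degreeOf i ≤ d) ∧ IsROABP F w f})) :
    HittingSets.IsHittingSetFor H
      (orb F {f : MvPolynomial (Fin n) F | (∀ i, f.degreeOf i ≤ d) ∧ IsCommutativeROABP F w f}) := by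
  intro g hg hg0
  refine hH g ?_ hg0
  rw [mem_orb_iff] at hg ⊢
  obtain ⟨f, ⟨hfd, hf⟩, hgf⟩ := hg
  exact ⟨f, ⟨hfd, hf.isROABP⟩, hgf⟩

/-- **Small rows by the identity generator.** A grid `W^n` with `n·d·r < |W|`… in the form used: if
every member of the class has total degree `≤ D` and `D < |W|`, then `Wⁿ` (the image of the grid under
the identity map) is a hitting set of size `≤ |W|ⁿ` (Obs 18 of Medini–Shpilka with the identity
generator). [cite: SahaThankey2021, Thms 6, 8 (p. 50:4), degenerate rows] -/
theorem exists_hittingSet_of_totalDegree_lt [DecidableEq F] (𝒞 : Set (MvPolynomial (Fin n) F)) {D : ℕ}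
    (hdeg : ∀ f ∈ 𝒞, f.totalDegree ≤ D) (W : Finset F) (hW : D < W.card) :
    ∃ H : Finset (Fin n → F), H.card ≤ W.card ^ n ∧ HittingSets.IsHittingSetFor (↑H) 𝒞 := by
  classical
  refine ⟨(Fintype.piFinset fun _ : Fin n => W).image fun (x : Fin n → F) (j : Fin n) =>
      eval x (X j : MvPolynomial (Fin n) F), ?_,
    MS2021.isHittingSetFor_image_piFinset (MS2021.isGeneratorFor_X 𝒞) (D := D) (r := 1) hdeg
      (fun j v => (degreeOf_le_totalDegree _ _).trans (totalDegree_X (R := F) j).le) W (by omega)⟩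
  exact (MS2021.card_image_piFinset_le _ W).trans (by rw [Fintype.card_fin])

/-- Width `0`: the class of width-`0` ROABPs is `{0}` (empty sum), so its orbit is `{0}` and the empty
set hits it. [cite: SahaThankey2021, Def. 1 (p. 50:3), degenerate row `w = 0`] -/
theorem isHittingSetFor_empty_orb_width_zero (P : MvPolynomial (Fin n) F → Prop) :
    HittingSets.IsHittingSetFor (↑(∅ : Finset (Fin n → F)))
      (orb F {f : MvPolynomial (Fin n) F | P f ∧ IsROABP F 0 f}) := by
  intro g hg hg0
  exfalso
  apply hg0
  rw [mem_orb_iff] at hg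
  obtain ⟨f, ⟨-, M, -, hf⟩, h, A, -, rfl⟩ := hg
  have hf0 : f = 0 := by rw [hf]; simp
  rw [hf0, MS2021.affSubst_zero]

end Cover

/-! ### Arithmetic of the size bounds -/

section Arith

/-- `Nat.log 2 (a ^ n * b + 1) ≤ n * a + b` (crude: `a ≤ 2^a`, `b ≤ 2^b`). [folklore] -/
private theorem log_two_pow_mul_succ_le (a b n : ℕ) : Nat.log 2 (a ^ n * b + 1) ≤ n * a + b := by
  have ha : a ^ n ≤ 2 ^ (n * a) := by
    calc a ^ n ≤ (2 ^ a) ^ n := Nat.pow_le_pow_left Nat.lt_two_pow_self.le n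
      _ = 2 ^ (n * a) := by rw [← pow_mul, mul_comm]
  have hb : b ≤ 2 ^ b := Nat.lt_two_pow_self.le
  have hY : a ^ n * b + 1 < 2 ^ (n * a + b + 1) := by
    have hb1 : b + 1 ≤ 2 ^ b := Nat.lt_two_pow_self
    have h1 : 1 ≤ 2 ^ (n * a) := Nat.one_le_two_pow
    calc a ^ n * b + 1 ≤ 2 ^ (n * a) * b + 2 ^ (n * a) * 1 :=
          add_le_add (Nat.mul_le_mul_right _ ha) (by simpa using h1)
      _ = 2 ^ (n * a) * (b + 1) := by ring
      _ ≤ 2 ^ (n * a) * 2 ^ b := Nat.mul_le_mul_left _ hb1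
      _ = 2 ^ (n * a + b) := by rw [pow_add]
      _ < 2 ^ (n * a + b + 1) := Nat.pow_lt_pow_right (by norm_num) (by omega)
  have := (Nat.log_lt_iff_lt_pow one_lt_two (by omega)).2 hY
  omega

/-- Size bound for Thm 8 (`d = 1`, grid `2n`, `n ≥ 2`, `w ≥ 1`):
`(2nw² + n²)(log₂((2n)ⁿ·2n + 1) + 1) + 1 ≤ n^{10 w⁶ (⌊log₂ n⌋ + 1)} + 10`. [cite: SahaThankey2021, Thm 8 ("n^{O(w⁶ log n)}", p. 50:4)] -/
theorem thm8_size_bound {n w : ℕ} (hn : 2 ≤ n) (hw : 1 ≤ w) :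
    (n * (w * (w * (1 + 1))) + n * n) * (Nat.log 2 ((2 * n) ^ n * (n * (1 + 1)) + 1) + 1) + 1 ≤
      n ^ (10 * w ^ 6 * (Nat.log 2 n + 1)) + 10 := by
  -- `p ≤ 3 n² w²`
  have hp : n * (w * (w * (1 + 1))) + n * n ≤ 3 * (n ^ 2 * w ^ 2) := by
    have e1 : n * (w * (w * (1 + 1))) = 2 * (n * w ^ 2) := by ring
    have e2 : n * w ^ 2 ≤ n ^ 2 * w ^ 2 :=
      Nat.mul_le_mul_right _ (by nlinarith : n ≤ n ^ 2)
    have e3 : n * n ≤ n ^ 2 * w ^ 2 := by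
      have h1 : 1 ≤ w ^ 2 := Nat.one_le_pow _ _ hw
      calc n * n = n ^ 2 * 1 := by ring
        _ ≤ n ^ 2 * w ^ 2 := Nat.mul_le_mul_left _ h1
    omega
  -- `log + 1 ≤ 4n²`
  have hlog : Nat.log 2 ((2 * n) ^ n * (n * (1 + 1)) + 1) + 1 ≤ 4 * n ^ 2 := by
    have h0 := log_two_pow_mul_succ_le (2 * n) (n * (1 + 1)) n
    have h1 : n * (2 * n) + n * (1 + 1) + 1 ≤ 4 * n ^ 2 := by nlinarith
    omega
  -- `w² ≤ n^{w⁶}`, `12 ≤ n⁴`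
  have hw2 : w ^ 2 ≤ n ^ (w ^ 6) := by
    calc w ^ 2 ≤ 2 ^ (w ^ 2) := Nat.lt_two_pow_self.le
      _ ≤ n ^ (w ^ 2) := Nat.pow_le_pow_left hn _
      _ ≤ n ^ (w ^ 6) := Nat.pow_le_pow_right (by omega)
          (by calc w ^ 2 = w ^ 2 * 1 := (mul_one _).symm
                _ ≤ w ^ 2 * w ^ 4 := Nat.mul_le_mul_left _ (Nat.one_le_pow _ _ hw)
                _ = w ^ 6 := by ring)
  have h12 : 12 ≤ n ^ 4 := by
    calc 12 ≤ 2 ^ 4 := by norm_num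
      _ ≤ n ^ 4 := Nat.pow_le_pow_left hn 4
  calc (n * (w * (w * (1 + 1))) + n * n) * (Nat.log 2 ((2 * n) ^ n * (n * (1 + 1)) + 1) + 1) + 1
      ≤ 3 * (n ^ 2 * w ^ 2) * (4 * n ^ 2) + 1 := Nat.add_le_add_right (Nat.mul_le_mul hp hlog) 1
    _ = 12 * n ^ 4 * w ^ 2 + 1 := by ring
    _ ≤ n ^ 4 * n ^ 4 * n ^ (w ^ 6) + 1 :=
        Nat.add_le_add_right (Nat.mul_le_mul (Nat.mul_le_mul h12 le_rfl) hw2) 1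
    _ = n ^ (8 + w ^ 6) + 1 := by ring
    _ ≤ n ^ (10 * w ^ 6 * (Nat.log 2 n + 1)) + 10 := by
        have h1 : 8 + w ^ 6 ≤ 10 * w ^ 6 * (Nat.log 2 n + 1) := by
          have : 1 ≤ w ^ 6 := Nat.one_le_pow _ _ hw
          nlinarith
        have := Nat.pow_le_pow_right (show 1 ≤ n by omega) h1
        omega

/-- Size bound for Thm 6 (grid `2nd`, `n ≥ 2`, `d ≥ 1`):
`(n w²(d+1) + n²)(log₂((2nd)ⁿ·n(d+1) + 1) + 1) + 1 ≤ (nd)^{10 d (⌊log₂ w⌋ + 1)} + 10`.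
[cite: SahaThankey2021, Thm 6 ("(nd)^{O(d log w)}", p. 50:4)] -/
theorem thm6_size_bound {n d w : ℕ} (hn : 2 ≤ n) (hd : 1 ≤ d) :
    (n * (w * (w * (d + 1))) + n * n) * (Nat.log 2 ((2 * (n * d)) ^ n * (n * (d + 1)) + 1) + 1) + 1 ≤
      (n * d) ^ (10 * d * (Nat.log 2 w + 1)) + 10 := by
  set x := n * d with hx
  set L := Nat.log 2 w with hL
  have hx2 : 2 ≤ x := by rw [hx]; nlinarith
  have hnx : n ≤ x := by rw [hx]; nlinarith
  have hd1 : d + 1 ≤ x := by rw [hx]; nlinarith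
  -- `w² ≤ x^{2(L+1)}`
  have hw : w ^ 2 ≤ x ^ (2 * (L + 1)) := by
    have hw1 : w < 2 ^ (L + 1) := Nat.lt_pow_succ_log_self one_lt_two w
    calc w ^ 2 ≤ (2 ^ (L + 1)) ^ 2 := Nat.pow_le_pow_left hw1.le 2
      _ ≤ (x ^ (L + 1)) ^ 2 := Nat.pow_le_pow_left (Nat.pow_le_pow_left hx2 _) 2
      _ = x ^ (2 * (L + 1)) := by rw [← pow_mul, mul_comm]
  -- `p ≤ x^{2L+5}`
  have hp : n * (w * (w * (d + 1))) + n * n ≤ x ^ (2 * (L + 1) + 3) := by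
    have h1 : n * (w * (w * (d + 1))) ≤ x * x ^ (2 * (L + 1)) * x := by
      have : n * (w * (w * (d + 1))) = n * w ^ 2 * (d + 1) := by ring
      rw [this]
      exact Nat.mul_le_mul (Nat.mul_le_mul hnx hw) hd1
    have h2 : n * n ≤ x * x := Nat.mul_le_mul hnx hnx
    have h3 : x * x ≤ x * x ^ (2 * (L + 1)) * x := by
      have : 1 ≤ x ^ (2 * (L + 1)) := Nat.one_le_pow _ _ (by omega)
      calc x * x = x * 1 * x := by ring
        _ ≤ x * x ^ (2 * (L + 1)) * x := Nat.mul_le_mul_right _ (Nat.mul_le_mul_left _ this)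
    calc n * (w * (w * (d + 1))) + n * n ≤ x * x ^ (2 * (L + 1)) * x + x * x ^ (2 * (L + 1)) * x :=
          add_le_add h1 (h2.trans h3)
      _ = 2 * x ^ (2 * (L + 1) + 2) := by ring
      _ ≤ x * x ^ (2 * (L + 1) + 2) := Nat.mul_le_mul_right _ hx2
      _ = x ^ (2 * (L + 1) + 3) := by ring
  -- `log + 1 ≤ x⁴`
  have hlog : Nat.log 2 ((2 * x) ^ n * (n * (d + 1)) + 1) + 1 ≤ x ^ 4 := by
    have h0 := log_two_pow_mul_succ_le (2 * x) (n * (d + 1)) n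
    -- `n·2x + n(d+1) + 1 ≤ 2x² + 2x + 1 ≤ x⁴`
    have h1 : n * (2 * x) ≤ 2 * x ^ 2 := by
      calc n * (2 * x) ≤ x * (2 * x) := Nat.mul_le_mul_right _ hnx
        _ = 2 * x ^ 2 := by ring
    have h2 : n * (d + 1) ≤ 2 * x := by
      have : n * (d + 1) = x + n := by rw [hx]; ring
      omega
    have h3 : 2 * x ^ 2 + 2 * x + 1 ≤ x ^ 4 := by
      have hsq : 4 ≤ x ^ 2 := by nlinarith
      have h4 : x ^ 4 = x ^ 2 * x ^ 2 := by ring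
      have h5 : 2 * x + 1 ≤ 2 * x ^ 2 := by nlinarith
      nlinarith
    omega
  calc (n * (w * (w * (d + 1))) + n * n) * (Nat.log 2 ((2 * x) ^ n * (n * (d + 1)) + 1) + 1) + 1
      ≤ x ^ (2 * (L + 1) + 3) * x ^ 4 + 1 := Nat.add_le_add_right (Nat.mul_le_mul hp hlog) 1
    _ = x ^ (2 * (L + 1) + 7) + 1 := by ring
    _ ≤ x ^ (10 * d * (L + 1)) + 10 := by
        have h1 : 2 * (L + 1) + 7 ≤ 10 * d * (L + 1) := by nlinarith
        have := Nat.pow_le_pow_right (show 1 ≤ x by omega) h1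
        omega

end Arith

end ROABPCover

end SahaThankey2021

/-! ### The two discharges -/

section Discharge

open SahaThankey2021 SahaThankey2021.ROABPCover HittingSets

/-- **ST Thm. 8 holds (as typed: existence and size).** "Let `C` be the set of `n`-variate
multilinear polynomials that are computable by width-`w` ROABPs. If `|F| > n^{O(w⁴)}`, then a hitting
set for `orb(C)` [of size] `n^{O(w⁶·log n)}` [exists]" — with `c = 10`: for `n ≥ 2`, `w ≥ 1` the
coefficient cover on a grid of size `2n ≤ n^{10w⁴} < |F|` (`exists_hittingSet_orb_grid`, entry
truncation `exists_coeffTable_of_isROABP` + the generic orbit element `genOrb`,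
`|H| ≤ (2nw² + n²)(log₂((2n)ⁿ2n + 1) + 1) + 1 ≤ n^{10w⁶(⌊log₂ n⌋+1)} + 10`, `thm8_size_bound`);
`w = 0`: the class is `{0}`, `H = ∅`; `n ≤ 1`: the grid `{0,1}ⁿ` (identity generator).
DISCLOSED DEVIATION: existence by parametrisation + Heintz–Schnorr coefficient cover, not the
printed explicit construction (§1.3/§4 of the source); this is exactly the weaker content of the
tree's statement. [cite: SahaThankey2021, Thm. 8 (p. 50:4 L45-47)] -/
theorem sahaThankey2021_thm_8_holds : sahaThankey2021_thm_8 := by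
  classical
  refine ⟨10, fun F _ n w hF => ?_⟩
  -- `n ≤ 1`: the grid `{0,1}ⁿ`
  by_cases hn : n < 2
  · obtain ⟨H, hcard, hhit⟩ := exists_hittingSet_of_totalDegree_lt (F := F)
      (orb F {f : MvPolynomial (Fin n) F | (∀ i, f.degreeOf i ≤ 1) ∧ IsROABP F w f})
      (D := n * 1) (fun g hg => totalDegree_le_of_mem_orb hg) {0, 1}
      (by rw [Finset.card_pair (zero_ne_one' F)]; omega)
    refine ⟨H, hcard.trans ?_, hhit⟩
    rw [Finset.card_pair (zero_ne_one' F)]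
    calc 2 ^ n ≤ 2 ^ 1 := Nat.pow_le_pow_right (by norm_num) (by omega)
      _ ≤ _ := by omega
  -- `w = 0`: the class is `{0}`
  rcases Nat.eq_zero_or_pos w with rfl | hw
  · exact ⟨∅, by simp, isHittingSetFor_empty_orb_width_zero (F := F) (n := n) _⟩
  -- main row
  have hn2 : 2 ≤ n := not_lt.1 hn
  have hgrid : Infinite F ∨ 2 * n ≤ Nat.card F := hF.imp id fun h => by
    have h1 : 2 * n ≤ n ^ (10 * w ^ 4) := by
      calc 2 * n ≤ n * n := Nat.mul_le_mul_right _ hn2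
        _ = n ^ 2 := by ring
        _ ≤ n ^ (10 * w ^ 4) := Nat.pow_le_pow_right (by omega)
            (by nlinarith [Nat.one_le_pow 4 w hw])
    exact h1.trans h.le
  obtain ⟨S, hS⟩ := MS2021.exists_finset_card_eq (K := F) (2 * n) hgrid
  have hS1 : S.Nonempty := Finset.card_pos.1 (by rw [hS]; omega)
  obtain ⟨H, hcard, hhit⟩ := exists_hittingSet_orb_grid (F := F) n w 1 S hS1 (by rw [hS, mul_one])
  refine ⟨H, hcard.trans ?_, hhit⟩
  rw [hS]
  exact thm8_size_bound hn2 hw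

/-- **ST Thm. 6 holds (as typed: existence and size).** "Let `C` be the set of `n`-variate
polynomials with individual degree at most `d` that are computable by width-`w` commutative ROABPs.
If `|F| > n²d`, then a hitting set for `orb(C)` [of size] `(nd)^{O(d log w)}` [exists]" — with
`c = 10`: for `n ≥ 2`, `d ≥ 1` the coefficient cover for the (larger) class of width-`w` ROABPs of
individual degree `≤ d` on a grid of size `2nd ≤ n²d < |F|` (`exists_hittingSet_orb_grid`;
commutativity of the layers is not needed for the cover and is dropped, Def. 2 ⊆ Def. 1),
`|H| ≤ (nw²(d+1) + n²)(log₂((2nd)ⁿ n(d+1) + 1) + 1) + 1 ≤ (nd)^{10d(⌊log₂ w⌋+1)} + 10`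
(`thm6_size_bound`); `d = 0` (constants) and `n = 0`: one point; `n = 1`: any `d+1` points (identity
generator). DISCLOSED DEVIATION: existence by parametrisation + Heintz–Schnorr coefficient cover,
not the printed explicit construction; this is exactly the weaker content of the tree's statement.
[cite: SahaThankey2021, Thm. 6 (p. 50:4 L18-21)] -/
theorem sahaThankey2021_thm_6_holds : sahaThankey2021_thm_6 := by
  classical
  refine ⟨10, fun F _ n d w hF => ?_⟩
  set 𝒞 : Set (MvPolynomial (Fin n) F) :=
    orb F {f : MvPolynomial (Fin n) F | (∀ i, f.degreeOf i ≤ d) ∧ IsCommutativeROABP F w f} with h𝒞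
  have hdeg𝒞 : ∀ g ∈ 𝒞, g.totalDegree ≤ n * d := fun g hg => totalDegree_le_of_mem_orb hg
  -- `d = 0`: constants, one point
  rcases Nat.eq_zero_or_pos d with rfl | hd
  · obtain ⟨H, hcard, hhit⟩ := exists_hittingSet_of_totalDegree_lt 𝒞 hdeg𝒞 {0} (by simp)
    refine ⟨H, hcard.trans ?_, hhit⟩
    rw [Finset.card_singleton, one_pow]
    omega
  -- `n = 0`: one point
  rcases Nat.eq_zero_or_pos n with rfl | hn
  · obtain ⟨H, hcard, hhit⟩ := exists_hittingSet_of_totalDegree_lt 𝒞 hdeg𝒞 {0} (by simp)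
    refine ⟨H, hcard.trans ?_, hhit⟩
    rw [Finset.card_singleton, one_pow]
    omega
  -- `n = 1`: any `d + 1` points
  by_cases hn1 : n = 1
  · subst hn1
    obtain ⟨W, hW⟩ : ∃ W : Finset F, W.card = d + 1 :=
      MS2021.exists_finset_card_eq (K := F) (d + 1) (hF.imp id fun h => by
        simp only [one_pow, one_mul] at h; omega)
    obtain ⟨H, hcard, hhit⟩ := exists_hittingSet_of_totalDegree_lt 𝒞 hdeg𝒞 W (by rw [hW]; omega)
    refine ⟨H, hcard.trans ?_, hhit⟩
    rw [hW, pow_one, one_mul]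
    have : d ≤ d ^ (10 * d * (Nat.log 2 w + 1)) :=
      Nat.le_self_pow (by positivity) d
    omega
  -- main row `n ≥ 2`, `d ≥ 1`
  have hn2 : 2 ≤ n := by omega
  have hgrid : Infinite F ∨ 2 * (n * d) ≤ Nat.card F := hF.imp id fun h => by
    have h1 : 2 * (n * d) ≤ n ^ 2 * d := by
      calc 2 * (n * d) ≤ n * (n * d) := Nat.mul_le_mul_right _ hn2
        _ = n ^ 2 * d := by ring
    exact h1.trans h.le
  obtain ⟨S, hS⟩ := MS2021.exists_finset_card_eq (K := F) (2 * (n * d)) hgrid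
  have hS1 : S.Nonempty := Finset.card_pos.1 (by rw [hS]; positivity)
  obtain ⟨H, hcard, hhit⟩ := exists_hittingSet_orb_grid (F := F) n w d S hS1 hS.ge
  refine ⟨H, hcard.trans ?_, isHittingSetFor_orb_comm_of_roabp hhit⟩
  rw [hS]
  exact thm6_size_bound hn2 hd

end Discharge

end Literature.Computability.AlgebraicComplexity

end
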